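import Summits.ResolutionOfSingularities.ResolutionOfSingularities.Theorems.MarkedTransferCampaignW46PlaneProcrastinationHolds
import HarnessLib

/-!
# [OURS · L1 W4.6 rung (i-c)] «INFINITE RUNS ON SURFACES PROCRASTINATE INFINITELY OFTEN» — the closing form of rung (i)
# on the plane, résumé-free and typed (cell res-hironaka, LADDER-RESOLUTION rung L, D-0089; campaign s46, prover
# res-L1-s46-pv-1; host route MarkedTransfer, `--supports stmt-ResolutionOfSingularities-16155`)

HONEST FRAMING. Nothing here is a statement of H. Hironaka's manuscript (2017-03-23, [Hironaka2017]) and nothing here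
asserts that any statement of it holds. Everything is OURS (campaign definitions of cell res-hironaka) or pure logic over
the OURS typed procedure (`Theorems.MarkedTransferCampaignW46TypedProcedure`, res-L1-type-o1) and this seat's résumé-free
reduction; the one geometric input is rung (i-b) `planeNonProcrastinatingTerminates_holds` (p526033, `K : Type`). The typed
candidate carriers enter only as posited résumés (through `CampaignW46.Run` / `RunNabla`). AI-written; weaker than expert
review. No `sorry`; axioms standard.

## What this file adds to rung (i) (RESCUE-SEED W4.6 (i) «surfaces», plane reading `Regime.dimLE 2`)

After rung (i-a) (isolated singular locus, p508559), rung (i-b) (non-procrastinating sequences, p526033) and the negative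
half (point-plat covers, p475556), rung (i) on the plane is a dichotomy. This file states its CLOSING FORM, valid for EVERY
infinite sequence and EVERY notion instance, with no hypothesis class:

* résumé-free, **RUNG (i-c)**: every infinite §2.1-permissible sequence of standard ideal exponents all of whose stages are
  surfaces (`topologicalKrullDim Z_k ≤ 2`) PROCRASTINATES INFINITELY OFTEN — for every `k₀` some step `k ≥ k₀` blows up a
  closed point lying on a curve of the singular locus (`PermissibleRun.exists_procrastinates_ge`,
  `PermissibleRun.infinite_setOf_procrastinates`); equivalently a sequence that procrastinates only finitely often is finite
  (`PermissibleRun.false_of_finite_setOf_procrastinates`). Proof: rung (i-b) applied to the shifted sequence `r.drop k₀`.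
* typed, for EVERY notion instance `N : Notions n` and EVERY reading `Rd` (no `NoStrayPoint`, no coverage hypothesis): every
  infinite run of the typed Th. 16.6 procedure on surfaces — literal sub-centre rule (`Run`) or ∇-centred (`RunNabla`) —
  has, beyond every stage, a step whose centre is a single closed point `ξ` of the terminal plat `∇(E_k)` through which a
  curve of `Sing(E_k)` passes (`Run.exists_procrastinates_ge`, `RunNabla.exists_strayPointStep_ge`): the résumés of a
  divergent run isolate stray points infinitely often. This is the exact complement of the typed rung (i-b)
  (`terminatesNabla_dimLE_two_of_noStrayPoint`, made unconditional here as `terminatesNabla_dimLE_two_of_noStrayPoint_holds`).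

## References

* companion modules of this campaign: `…PlaneProcrastination` (p515754: `Procrastinates`, `PlaneNonProcrastinatingTerminates`,
  `Resumes.NoStrayPoint`), `…PlaneProcrastinationHolds` (p526033), `…PermissibleReduction` (p469934: `PermissibleRun.drop`),
  `…ProcrastinationNabla` (p475556, the negative half).
* H. Hironaka, ms. 2017-03-23, Th. 16.6 p.84 l.4–9, Th. 16.13 p.87 l.26–28 — scope only, under adjudication, not cited as
  fact. [Hironaka2017]
-/

noncomputable section

set_option linter.dupNamespace false -- mandated namespace of this single-conjunct summit

open CategoryTheory AlgebraicGeometry TopologicalSpace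

namespace Summit.ResolutionOfSingularities.ResolutionOfSingularities.Theorems

namespace CampaignW46

open Literature.AlgebraicGeometry.Resolution
open Literature.AlgebraicGeometry.Hironaka2017.S02Preliminaries
open Literature.AlgebraicGeometry.Hironaka2017.Datum

universe u

/-! ## Pure logic: shifting a sequence does not change its stages, regimes or procrastinating steps -/

section Shift

variable {p : ℕ} [Fact p.Prime] {K : Type u} [Field K] [CharP K p]

namespace PermissibleRun

/-- Pure logic: stage `k` of the sequence shifted by `j` lies in the regime `Rg` iff stage `k + j` of the original one does
(the stages agree definitionally, `PermissibleRun.drop`). [folklore] -/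
theorem drop_regime_iff (Rg : Regime p K) (r : PermissibleRun p K) (j k : ℕ) :
    Rg ((r.drop j).A k) ((r.drop j).E k) ↔ Rg (r.A (k + j)) (r.E (k + j)) := by
  induction j generalizing k with
  | zero => exact Iff.rfl
  | succ j ih =>
    rw [show k + (j + 1) = (k + 1) + j by omega]
    exact ih (k + 1)

/-- Pure logic: step `k` of the sequence shifted by `j` procrastinates iff step `k + j` of the original one does.
[folklore] -/
theorem drop_procrastinates_iff (r : PermissibleRun p K) (j k : ℕ) :
    (r.drop j).Procrastinates k ↔ r.Procrastinates (k + j) := by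
  induction j generalizing k with
  | zero => exact Iff.rfl
  | succ j ih =>
    rw [show k + (j + 1) = (k + 1) + j by omega]
    exact ih (k + 1)

end PermissibleRun

end Shift

/-! ## Rung (i-c), résumé-free: infinite sequences on surfaces procrastinate infinitely often (`K : Type`) -/

section Plane

variable {p : ℕ} [Fact p.Prime] {K : Type} [Field K] [CharP K p]

namespace PermissibleRun

/-- [OURS · L1 W4.6 rung (i-c)] NOT a statement of the manuscript. **RUNG (i-c) — every infinite §2.1-permissible
sequence on surfaces procrastinates beyond every stage**: for an infinite permissible sequence of standard ideal
exponents all of whose stages are surfaces (`topologicalKrullDim Z_k ≤ 2`; every field `K : Type` of characteristic `p`)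
and every `k₀` there is a step `k ≥ k₀` that blows up a closed point lying on a curve of `Sing(E_k)`. Replaces the role of
the termination clause of Th. 16.13 p.87 l.26–28 on surfaces in its sharpest résumé-free form («the only way not to
terminate is to procrastinate forever»). Proof: rung (i-b) (`planeNonProcrastinatingTerminates_holds`) for the shifted
sequence `r.drop k₀`. [folklore] -/
theorem exists_procrastinates_ge (r : PermissibleRun p K) (hdim : ∀ k, Regime.dimLE 2 (r.A k) (r.E k)) (k₀ : ℕ) :
    ∃ k, k₀ ≤ k ∧ r.Procrastinates k := by
  by_contra h
  push Not at h
  refine planeNonProcrastinatingTerminates_holds p K (r.drop k₀)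
    (fun k => (r.drop_regime_iff (Regime.dimLE 2) k₀ k).mpr (hdim (k + k₀))) fun k hk => ?_
  exact h (k + k₀) (Nat.le_add_left k₀ k) ((r.drop_procrastinates_iff k₀ k).mp hk)

/-- [OURS · L1 W4.6 rung (i-c)] NOT a statement of the manuscript. The same, as a statement about the set of
procrastinating steps: it is INFINITE for every infinite §2.1-permissible sequence on surfaces. [folklore] -/
theorem infinite_setOf_procrastinates (r : PermissibleRun p K) (hdim : ∀ k, Regime.dimLE 2 (r.A k) (r.E k)) :
    {k | r.Procrastinates k}.Infinite :=
  Nat.frequently_atTop_iff_infinite.mp (Filter.frequently_atTop.mpr (r.exists_procrastinates_ge hdim))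

/-- [OURS · L1 W4.6 rung (i-c)] NOT a statement of the manuscript. Contrapositive form: a §2.1-permissible sequence on
surfaces that procrastinates at only FINITELY many steps is finite (there is no infinite one) — rung (i-b) is the case of
no procrastinating step at all. [folklore] -/
theorem false_of_finite_setOf_procrastinates (r : PermissibleRun p K) (hdim : ∀ k, Regime.dimLE 2 (r.A k) (r.E k))
    (hfin : {k | r.Procrastinates k}.Finite) : False :=
  r.infinite_setOf_procrastinates hdim hfin

end PermissibleRun

/-! ## Rung (i-c), typed: every notion instance, every reading -/

variable {n : ℕ} {N : Notions.{0} n} {Rd : Reading p K N}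

/-- [OURS · L1 W4.6 rung (i-c)] NOT a statement of the manuscript. **Typed rung (i-c), literal sub-centre rule, EVERY
notion instance `N` and reading `Rd`**: an infinite run of the typed Th. 16.6 procedure all of whose stages are surfaces
procrastinates beyond every stage — some step `k ≥ k₀` has centre a single closed point `ξ` (of `∇(E_k)`) through which a
curve of `Sing(E_k)` passes. No hypothesis on `N` (résumés enter only as the run's posited data). [folklore] -/
theorem Run.exists_procrastinates_ge (r : Run N Rd) (hdim : ∀ k, Regime.dimLE 2 (r.A k) (r.E k)) (k₀ : ℕ) :
    ∃ k, k₀ ≤ k ∧ ∃ ξ η : (r.A k).Z,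
      ((r.step k).D : Set (r.A k).Z) = {ξ} ∧ η ∈ (r.E k).sing ∧ η ≠ ξ ∧ η ⤳ ξ :=
  r.toPermissibleRun.exists_procrastinates_ge hdim k₀

/-- [OURS · L1 W4.6 rung (i-c)] NOT a statement of the manuscript. **Typed rung (i-c), ∇-centred procedure, EVERY notion
instance `N` and reading `Rd`**: an infinite ∇-centred run of the typed Th. 16.6 procedure all of whose stages are
surfaces has, beyond every stage `k₀`, a STRAY-POINT STEP — a step `k ≥ k₀` whose centre, an irreducible component of the
terminal plat `∇(E_k)` (`IsNablaComponent`), is a single closed point `ξ` lying on a curve of `Sing(E_k)` (some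
`η ∈ Sing(E_k)`, `η ≠ ξ`, `η ⤳ ξ`). So the résumés of a divergent ∇-centred run on surfaces isolate stray points
infinitely often — the exact complement of the typed rung (i-b) `terminatesNabla_dimLE_two_of_noStrayPoint_holds`; with
the negative half `not_terminatesNabla_dimLE_of_pointPlatCover_plane` (p475556) this is the whole of rung (i) on the
plane. [folklore] -/
theorem RunNabla.exists_strayPointStep_ge (r : RunNabla N Rd) (hdim : ∀ k, Regime.dimLE 2 (r.A k) (r.E k)) (k₀ : ℕ) :
    ∃ k, k₀ ≤ k ∧ IsNablaComponent (r.R k) (r.step k).toStep.D ∧ ∃ ξ η : (r.A k).Z,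
      ((r.step k).toStep.D : Set (r.A k).Z) = {ξ} ∧ η ∈ (r.E k).sing ∧ η ≠ ξ ∧ η ⤳ ξ := by
  obtain ⟨k, hk, hP⟩ := r.toRun.toPermissibleRun.exists_procrastinates_ge hdim k₀
  exact ⟨k, hk, (r.step k).component, hP⟩

/-- [OURS · L1 W4.6 rung (i-c)] NOT a statement of the manuscript. The set of stray-point (procrastinating) steps of an
infinite ∇-centred run on surfaces is infinite, for every `N`, `Rd`. [folklore] -/
theorem RunNabla.infinite_setOf_procrastinates (r : RunNabla N Rd) (hdim : ∀ k, Regime.dimLE 2 (r.A k) (r.E k)) :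
    {k | r.toRun.toPermissibleRun.Procrastinates k}.Infinite :=
  r.toRun.toPermissibleRun.infinite_setOf_procrastinates hdim

/-- [OURS · L1 W4.6 rung (i-b), unconditional] NOT a statement of the manuscript. **THE TYPED RUNG (i-b) HOLDS**: the
∇-centred typed Th. 16.6 procedure terminates on surfaces (`TerminatesNabla N Rd (Regime.dimLE 2)`, every field `K : Type`
of characteristic `p`) for EVERY notion instance `N` and reading `Rd` whose résumés never isolate a point of a singular
curve (`Resumes.NoStrayPoint N Rd`) — `terminatesNabla_dimLE_two_of_noStrayPoint` (p515754) discharged by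
`planeNonProcrastinatingTerminates_holds` (p526033). [folklore] -/
theorem terminatesNabla_dimLE_two_of_noStrayPoint_holds (hN : Resumes.NoStrayPoint N Rd) :
    TerminatesNabla N Rd (Regime.dimLE 2 (p := p) (K := K)) :=
  terminatesNabla_dimLE_two_of_noStrayPoint (planeNonProcrastinatingTerminates_holds p K) hN

end Plane

end CampaignW46

end Summit.ResolutionOfSingularities.ResolutionOfSingularities.Theorems

end
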